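import Summits.NavierStokesRegularity.NavierStokesRegularity.Theses.GaldiLiouvilleGate
import Summits.NavierStokesRegularity.NavierStokesRegularity.Theorems.GaldiLiouvilleGateRecordZoomAncientStubTaoRep
import Summits.NavierStokesRegularity.NavierStokesRegularity.Theorems.GaldiLiouvilleGateRecordZoomAncientStubEnstrophyPersistence
import Summits.NavierStokesRegularity.NavierStokesRegularity.Theorems.GaldiLiouvilleGateRecordZoomAncientStubTypeIBranch
import Summits.NavierStokesRegularity.NavierStokesRegularity.Theorems.GaldiLiouvilleGateRecordZoomAncientStubZoomBound
import Summits.NavierStokesRegularity.NavierStokesRegularity.Theorems.GaldiLiouvilleGateRecordZoomAncientStubZoomLimit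
import Summits.NavierStokesRegularity.NavierStokesRegularity.Theorems.GaldiLiouvilleGateRecordZoomAncientStubFastBranch
import Summits.NavierStokesRegularity.NavierStokesRegularity.Theorems.GaldiLiouvilleGateRecordZoomAncientStubOseenC1kappa
import Summits.NavierStokesRegularity.NavierStokesRegularity.Theorems.GaldiLiouvilleGateRecordZoomAncientStubZoomC1kappa
import Summits.NavierStokesRegularity.NavierStokesRegularity.Theorems.GaldiLiouvilleGateRecordZoomAncientStubEnstrophyConcentrationBranch
import Summits.NavierStokesRegularity.NavierStokesRegularity.Theorems.GaldiLiouvilleGateRecordZoomAncientStubVelocityBranch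
import Literature.Analysis.FluidPDE.TaoClassGlue
import Literature.Analysis.FluidPDE.NSLerayBlowupRateTopHolds
import HarnessLib

/-!
# Route `GaldiLiouvilleGate`, crux `RecordZoomAncient` (stmt-NavierStokesRegularity-0894),
  line `registered` (birth skeleton, reshape r5) — the REDUCTION OF THE CRUX TO ITS OPEN KERNEL,
  as closed theorems

The crux `Z = Theses.GaldiLiouvilleGate.RecordZoomAncient` (a classical Navier–Stokes solution on
`ℝ³ × [0, T)`, Leray–Hopf from a rapidly decaying datum, with no smooth extension past `T`,
generates a NONTRIVIAL bounded ancient mild solution `v`, `ν = 1`, smooth on `(−∞,0) × ℝ³`, with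
`sup_{s<0} ∫|∇v(s)|² ≤ 1` and `L⁶` slices) was cut by the line `registered` into eleven stubs, ten
of which are theorems of this directory (`stub_taoRep`, `stub_enstrophyPersistence`,
`stub_typeIBranch`, `stub_fastBranch`, `stub_enstrophyConcentrationBranch`, `stub_velocityBranch`,
`stub_zoomBound`, `stub_oseenC1kappa`, `stub_zoomC1kappa`, `stub_zoomLimit`). This file turns the
composition of the skeleton (`Cruxes/RecordZoomAncient/Lines/birth.lean`, r5) into CLOSED theorems
whose only hypothesis is the one open stub, so that the crux closes by a single `exact` the day
that statement is proved. Notation: `E(s) = ∫⁻ |∇u(s)|²`; a level `L > 0` DOMINATES at `t` if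
`E ≤ L` on `[0, t]`; the enstrophy-normalised zoom based at `(tc, xc)` with level `L` is
`z(s, y) = (ν/L) u(tc + ν³ s/L², xc + (ν²/L) y)` (viscosity `1`, enstrophy `≤ 1` on the dominated
past).

* `recordZoomAncient_of_concentratedZooms` — the common tail: velocity-concentrated zooms (base
  times `tc n`, centres `xc n`, dominating levels `L n`, `tc n (L n)² → ∞`, and
  `‖z_n(s₀, 0)‖ ≥ θ > 0`) give the conclusion of `Z` for that solution (universal bound after one
  critical time unit, `stub_zoomBound`; KNSS compactness, `stub_zoomLimit`; non-triviality read off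
  at `(s₀, 0)` from the pointwise convergence).
* `recordZoomAncient_of_frequentCriticalVelocity` — `Z` follows from FREQUENT CRITICAL VELOCITY
  ("no faint blow-up", the clean form of the kernel): for every blow-up as in `Z` there is `θ > 0`
  such that arbitrarily close to `T` some time `t`, point `x` and dominating level `L` have
  `‖u(t, x)‖ ≥ θ L/ν` (bounded local Reynolds number `sup_{[0,t]} E/(ν‖u(t)‖_∞)` of the
  enstrophy-carrying scale, infinitely often). Composition: `stub_taoRep`, `stub_enstrophyPersistence`,
  `stub_velocityBranch`, then the tail.
* `recordZoomAncient_of_noFaintBlowupKernel` — `Z` follows from the REGISTERED stub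
  `stub_thinSlowKernel` of the r5 skeleton taken verbatim as a hypothesis (the formally weakest
  form: it may also use Type-II enstrophy, eventually-slow doubling at every scale and vanishing of
  the enstrophy at the critical scale, which the composition supplies through the landed branches
  `stub_typeIBranch` / `stub_fastBranch` / `stub_enstrophyConcentrationBranch` and Leray's `L^∞`
  rate `leray_blowup_rate_top_holds`). This is the closed twin `Lines/birth_closed.lean` of the
  skeleton, made importable.

Neither hypothesis is a Literature fact: "no faint blow-up" is the open content of the crux (a
counterexample would itself be a finite-time singularity; Tao's averaged cascade, arXiv:1402.0290,
is its model inhabitant, barrier `Literature.Barriers.NavierStokesRegularity.TaoAveragedBlowup`).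
The theorems here are the kernel-checked statement "Z is proved modulo exactly that".
-/

noncomputable section

open Set MeasureTheory Filter Topology Function
open scoped ENNReal NNReal
open Literature.Analysis.FluidPDE

namespace Summit.NavierStokesRegularity.NavierStokesRegularity.Theorems.RecordZoomAncient.Birth

-- the problem-side namespace `Summit.NavierStokesRegularity.NavierStokesRegularity.…` (summit =
-- problem for this single-problem summit) duplicates `NavierStokesRegularity` by design
set_option linter.dupNamespace false

/-- From `ENNReal.ofReal a ≤ ‖f‖_{L^∞}` with `0 < a` there is a point where `‖f x‖ ≥ a/2`
(otherwise `eLpNorm_top_le_of_bound` bounds the `L^∞` norm by `a/2 < a`). Used to turn Leray's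
`L^∞` blow-up rate into a pointwise lower bound. -/
theorem exists_half_le_norm_of_ofReal_le_eLpNorm_top
    {f : EuclideanSpace ℝ (Fin 3) → EuclideanSpace ℝ (Fin 3)} {a : ℝ} (ha : 0 < a)
    (h : ENNReal.ofReal a ≤ eLpNorm f ∞ volume) : ∃ x, a / 2 ≤ ‖f x‖ := by
  by_contra hne
  push Not at hne
  have hle : eLpNorm f ∞ volume ≤ ENNReal.ofReal (a / 2) :=
    eLpNorm_top_le_of_bound fun x => (hne x).le
  have hlt : ENNReal.ofReal (a / 2) < ENNReal.ofReal a :=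
    (ENNReal.ofReal_lt_ofReal_iff ha).2 (by linarith)
  exact absurd (h.trans hle) (not_le.2 hlt)

/-- **The common tail of the line.** For a classical solution on `[0, T)`, Leray–Hopf from a
rapidly decaying datum: velocity-concentrated enstrophy-normalised zooms — base times
`tc n ∈ (0, T)`, centres `xc n`, levels `L n > 0` dominating `E` on `[0, tc n]`,
`tc n · (L n)² → ∞`, and a rescaled time `s₀ < 0` with `‖(ν/L n) u(tc n + ν³ s₀/(L n)², xc n)‖ ≥ θ > 0`
for all `n` — produce a nontrivial bounded ancient mild solution (`ν = 1`), smooth, with enstrophy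
`≤ 1` and `L⁶` slices. Proof: the Tao representation (`stub_taoRep`) feeds the universal velocity
bound after one critical time unit (`stub_zoomBound`) and the KNSS compactness of the zooms
(`stub_zoomLimit`); if the limit `v` vanished identically then `‖z_{φ n}(s₀, 0)‖ → 0` by the
pointwise convergence at `(s₀, 0)`, contradicting `≥ θ`. -/
theorem recordZoomAncient_of_concentratedZooms
    (ν T : ℝ) (hν : 0 < ν) (hT : 0 < T)
    (u : ℝ → EuclideanSpace ℝ (Fin 3) → EuclideanSpace ℝ (Fin 3)) (p : ℝ → EuclideanSpace ℝ (Fin 3) → ℝ)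
    (hcl : IsClassicalNSSolutionOn (Set.Ico 0 T) ν 0 u p) (hLH : IsLerayHopfOn T ν 0 (u 0) u)
    (hdec : HasRapidSpatialDecay (u 0))
    (tc : ℕ → ℝ) (xc : ℕ → EuclideanSpace ℝ (Fin 3)) (L : ℕ → ℝ) (s₀ θ : ℝ)
    (hs₀ : s₀ < 0) (hθ : 0 < θ) (htc : ∀ n, 0 < tc n ∧ tc n < T) (hL : ∀ n, 0 < L n)
    (hdom : ∀ n, ∀ t ∈ Set.Icc 0 (tc n),
      ∫⁻ x, ENNReal.ofReal (frobeniusNormSq (fderiv ℝ (u t) x)) ≤ ENNReal.ofReal (L n))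
    (hpast : Tendsto (fun n => tc n * L n ^ 2) atTop atTop)
    (hconc : ∀ n, θ ≤ ‖(ν / L n) • u (tc n + ν ^ 3 / L n ^ 2 * s₀) (xc n)‖) :
    ∃ v : ℝ → EuclideanSpace ℝ (Fin 3) → EuclideanSpace ℝ (Fin 3),
      IsBoundedAncientMildSolution 1 v ∧
      ContDiffOn ℝ (⊤ : ℕ∞) (Function.uncurry v) (Set.Iio 0 ×ˢ Set.univ) ∧
      (∀ s < 0, ∫⁻ y, ENNReal.ofReal (frobeniusNormSq (fderiv ℝ (v s) y)) ≤ 1) ∧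
      (∀ s < 0, MemLp (v s) 6 volume) ∧ ¬ (∀ s < 0, ∀ y, v s y = 0) := by
  -- the representation: `u` is Tao-class on every `[0, T']`, `T' < T`
  have hrep : ∀ T' ∈ Set.Ioo 0 T, ∃ P : ℝ → EuclideanSpace ℝ (Fin 3) → ℝ, IsTaoSolutionOn T' ν (u 0) u P :=
    stub_taoRep ν T hν hT u p hcl hLH hdec
  -- the universal bound after one critical time unit
  obtain ⟨C, hC⟩ := stub_zoomBound
  have hbd : ∀ n, ∀ t ∈ Set.Icc (ν ^ 3 / L n ^ 2) (tc n), ∀ x, ‖u t x‖ ≤ C * L n / ν :=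
    fun n t ht x => hC ν T hν hT u p hcl hLH hdec hrep (tc n) (L n) (htc n).1 (htc n).2 (hL n) (hdom n) t ht x
  -- the zooms, pinned by their defining equation
  set z : ℕ → ℝ → EuclideanSpace ℝ (Fin 3) → EuclideanSpace ℝ (Fin 3) :=
    fun n s y => (ν / L n) • u (tc n + ν ^ 3 / L n ^ 2 * s) (xc n + (ν ^ 2 / L n) • y) with hz_def
  have hz : ∀ n s y, z n s y = (ν / L n) • u (tc n + ν ^ 3 / L n ^ 2 * s) (xc n + (ν ^ 2 / L n) • y) :=
    fun n s y => rfl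
  -- a subsequential limit with all the analytic properties of the crux
  obtain ⟨φ, v, hφ, hconv, hmild, hsmooth, hens, hL6⟩ :=
    stub_zoomLimit ν T hν hT u p hcl hLH hdec hrep tc xc L htc hL hdom hpast C hbd z hz
  refine ⟨v, hmild, hsmooth, hens, hL6, ?_⟩
  -- non-triviality, read off at the rescaled time `s₀` and the origin
  intro hzero
  have hslice0 : v s₀ 0 = 0 := hzero _ hs₀ 0
  have hlim : Tendsto (fun n => ‖z (φ n) s₀ 0‖) atTop (𝓝 0) := by
    have h := (hconv _ hs₀ 0).norm
    rwa [hslice0, norm_zero] at h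
  have hlow : ∀ n, θ ≤ ‖z (φ n) s₀ 0‖ := fun n => by
    have h := hconc (φ n)
    simpa only [hz, smul_zero, add_zero] using h
  have hθle : θ ≤ 0 := ge_of_tendsto' hlim hlow
  linarith

/-- **`Z` from frequent critical velocity ("no faint blow-up", clean form of the kernel).**
Hypothesis: for every `ν, T > 0` and every classical solution `(u, p)` on `ℝ³ × [0, T)`,
Leray–Hopf from the rapidly decaying `u 0`, with no smooth extension past `T`, there is `θ > 0`
such that for every `t' < T` some time `t ∈ [t', T)`, point `x` and level `L > 0` dominating the
enstrophy on `[0, t]` satisfy `‖u(t, x)‖ ≥ θ L/ν`. Conclusion: the crux `RecordZoomAncient`.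
Proof: Tao representation (`stub_taoRep`), persistence constants (`stub_enstrophyPersistence`),
velocity-concentrated zooms (`stub_velocityBranch`), then `recordZoomAncient_of_concentratedZooms`.
The hypothesis is OPEN (it fails exactly for a blow-up whose local Reynolds number at the
enstrophy-carrying scale tends to infinity; no theorem in print excludes that); it is stated
inline, not as a fact. -/
theorem recordZoomAncient_of_frequentCriticalVelocity :
    (∀ (ν T : ℝ), 0 < ν → 0 < T →
      ∀ (u : ℝ → EuclideanSpace ℝ (Fin 3) → EuclideanSpace ℝ (Fin 3)) (p : ℝ → EuclideanSpace ℝ (Fin 3) → ℝ),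
        IsClassicalNSSolutionOn (Set.Ico 0 T) ν 0 u p → IsLerayHopfOn T ν 0 (u 0) u →
        HasRapidSpatialDecay (u 0) → ¬ HasSmoothExtensionPast ν 0 u T →
        ∃ θ : ℝ, 0 < θ ∧ ∀ t' ∈ Set.Ico 0 T, ∃ t ∈ Set.Ico t' T,
          ∃ x : EuclideanSpace ℝ (Fin 3), ∃ L : ℝ, 0 < L ∧
            (∀ s ∈ Set.Icc 0 t,
              (∫⁻ x, ENNReal.ofReal (frobeniusNormSq (fderiv ℝ (u s) x))) ≤ ENNReal.ofReal L) ∧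
            θ * L / ν ≤ ‖u t x‖) →
    Summit.NavierStokesRegularity.NavierStokesRegularity.Theses.GaldiLiouvilleGate.RecordZoomAncient := by
  intro hFCV ν T hν hT u p hcl hLH hdec hnext
  -- (0) the representation
  have hrep : ∀ T' ∈ Set.Ioo 0 T, ∃ P : ℝ → EuclideanSpace ℝ (Fin 3) → ℝ, IsTaoSolutionOn T' ν (u 0) u P :=
    stub_taoRep ν T hν hT u p hcl hLH hdec
  -- (1) persistence constants
  obtain ⟨cP, K, hcP, hK, hpers⟩ := stub_enstrophyPersistence
  have hpers' := hpers ν T hν hT u p hcl hrep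
  -- (2) velocity-concentrated zooms from frequent critical velocity
  obtain ⟨θ₀, hθ₀, hV⟩ := hFCV ν T hν hT u p hcl hLH hdec hnext
  obtain ⟨tc, xc, L, s₀, θ, hs₀, hθ, htc, hL, hdom, hpast, hconc⟩ :=
    stub_velocityBranch ν T hν hT u p hcl hLH hrep hnext cP K hcP hK hpers' θ₀ hθ₀ hV
  -- (3) the common tail
  exact recordZoomAncient_of_concentratedZooms ν T hν hT u p hcl hLH hdec tc xc L s₀ θ hs₀ hθ htc hL
    hdom hpast hconc

/-- **`Z` from the registered kernel `stub_thinSlowKernel` (r5), verbatim as a hypothesis — the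
closed twin of the skeleton `Cruxes/RecordZoomAncient/Lines/birth.lean`.** The hypothesis says
that no classical Leray–Hopf solution from a rapidly decaying datum blows up at `T` in the regime
TYPE-II ENSTROPHY (`∀ C`, eventually `E > C ν^{3/2}/√(T−t)` somewhere on `[0, t]`) ∧ EVENTUALLY
SLOW DOUBLING AT EVERY SCALE (`∀ K`, eventually every record doubling `L → 2L` takes
`≥ K ν³/L²`) ∧ VANISHING AT THE CRITICAL SCALE (`∀ R ε`, eventually every ball of `R` critical
radii `ν²/L` carries `< εL` of `E(t)`) ∧ FAINT (`∀ θ`, eventually `‖u(t, x)‖ < θ L/ν` for every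
`x` and every dominating level `L`). Composition (r5): representation (`stub_taoRep`), persistence
(`stub_enstrophyPersistence`), Leray's `L^∞` rate (`leray_blowup_rate_top_holds`, strip bound read
off the representation), then a four-fold case split — Type-I enstrophy along a sequence
(`stub_typeIBranch`) / fast doubling at some scale (`stub_fastBranch`) / enstrophy concentration
at the critical scale (`stub_enstrophyConcentrationBranch`, with the uniform `C^{1,κ}` bounds of
`stub_zoomC1kappa stub_oseenC1kappa`) / frequent critical velocity (`stub_velocityBranch`) / else
the kernel's `False` — and the common tail `recordZoomAncient_of_concentratedZooms`. -/
theorem recordZoomAncient_of_noFaintBlowupKernel :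
    (∀ (ν T : ℝ), 0 < ν → 0 < T →
      ∀ (u : ℝ → EuclideanSpace ℝ (Fin 3) → EuclideanSpace ℝ (Fin 3)) (p : ℝ → EuclideanSpace ℝ (Fin 3) → ℝ),
        IsClassicalNSSolutionOn (Set.Ico 0 T) ν 0 u p → IsLerayHopfOn T ν 0 (u 0) u →
        HasRapidSpatialDecay (u 0) → ¬ HasSmoothExtensionPast ν 0 u T →
        (∀ C : ℝ, 0 < C → ∃ t' ∈ Set.Ico 0 T, ∀ t ∈ Set.Ico t' T, ∃ s ∈ Set.Icc 0 t,
            ENNReal.ofReal (C * (ν * Real.sqrt ν) / Real.sqrt (T - t)) <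
              ∫⁻ x, ENNReal.ofReal (frobeniusNormSq (fderiv ℝ (u s) x))) →
        (∀ K : ℝ, 0 < K → ∃ t' ∈ Set.Ico 0 T, ∀ t₁ ∈ Set.Ico t' T, ∀ t₂ ∈ Set.Ioo t₁ T, ∀ L : ℝ, 0 < L →
            (∀ s ∈ Set.Icc 0 t₂,
              (∫⁻ x, ENNReal.ofReal (frobeniusNormSq (fderiv ℝ (u s) x))) ≤ ENNReal.ofReal (2 * L)) →
            (∫⁻ x, ENNReal.ofReal (frobeniusNormSq (fderiv ℝ (u t₁) x))) ≤ ENNReal.ofReal L →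
            ENNReal.ofReal (2 * L) ≤ (∫⁻ x, ENNReal.ofReal (frobeniusNormSq (fderiv ℝ (u t₂) x))) →
            K * ν ^ 3 / L ^ 2 ≤ t₂ - t₁) →
        (∀ R ε : ℝ, 0 < R → 0 < ε → ∃ t' ∈ Set.Ico 0 T, ∀ t ∈ Set.Ico t' T,
            ∀ x : EuclideanSpace ℝ (Fin 3), ∀ L : ℝ, 0 < L →
            (∀ s ∈ Set.Icc 0 t,
              (∫⁻ x, ENNReal.ofReal (frobeniusNormSq (fderiv ℝ (u s) x))) ≤ ENNReal.ofReal L) →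
            3 * ν ^ 3 / L ^ 2 ≤ t →
            (∫⁻ y in Metric.ball x (R * ν ^ 2 / L), ENNReal.ofReal (frobeniusNormSq (fderiv ℝ (u t) y))) <
              ENNReal.ofReal (ε * L)) →
        (∀ θ : ℝ, 0 < θ → ∃ t' ∈ Set.Ico 0 T, ∀ t ∈ Set.Ico t' T,
            ∀ x : EuclideanSpace ℝ (Fin 3), ∀ L : ℝ, 0 < L →
            (∀ s ∈ Set.Icc 0 t,
              (∫⁻ x, ENNReal.ofReal (frobeniusNormSq (fderiv ℝ (u s) x))) ≤ ENNReal.ofReal L) →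
            ‖u t x‖ < θ * L / ν) →
        False) →
    Summit.NavierStokesRegularity.NavierStokesRegularity.Theses.GaldiLiouvilleGate.RecordZoomAncient := by
  intro hKernel ν T hν hT u p hcl hLH hdec hnext
  -- (0) the representation: `u` is Tao-class on every `[0, T']`, `T' < T`
  have hrep : ∀ T' ∈ Set.Ioo 0 T, ∃ P : ℝ → EuclideanSpace ℝ (Fin 3) → ℝ, IsTaoSolutionOn T' ν (u 0) u P :=
    stub_taoRep ν T hν hT u p hcl hLH hdec
  -- (1) persistence constants
  obtain ⟨cP, K, hcP, hK, hpers⟩ := stub_enstrophyPersistence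
  have hpers' := hpers ν T hν hT u p hcl hrep
  -- Leray's `L^∞` blow-up rate (tree theorem), strip-boundedness from the representation
  obtain ⟨cL, hcL, hLer⟩ := leray_blowup_rate_top_holds
  have hstrip : ∀ T' ∈ Set.Ioo 0 T,
      eLpNorm (uncurry u) ∞ (volume.restrict (Set.Icc 0 T' ×ˢ univ)) < ∞ := by
    intro T' hT'
    obtain ⟨P, hP⟩ := hrep T' hT'
    obtain ⟨B, -, hB⟩ := hP.exists_bound_velocity
    rw [eLpNorm_exponent_top]
    refine eLpNormEssSup_lt_top_of_ae_bound (C := B) ?_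
    filter_upwards [ae_restrict_mem (measurableSet_Icc.prod MeasurableSet.univ)] with w hw
    obtain ⟨t, x⟩ := w
    exact hB t hw.1 x
  have hrate : ∀ t ∈ Set.Ico 0 T, ∃ x, cL / 2 * Real.sqrt ν / Real.sqrt (T - t) ≤ ‖u t x‖ := by
    intro t ht
    have h := hLer ν T hν hT u p ⟨hcl, hnext⟩ hLH hstrip t ht
    have ha : 0 < cL * Real.sqrt ν / Real.sqrt (T - t) := by
      have h1 : 0 < Real.sqrt ν := Real.sqrt_pos.2 hν
      have h2 : 0 < Real.sqrt (T - t) := Real.sqrt_pos.2 (sub_pos.2 ht.2)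
      positivity
    obtain ⟨x, hx⟩ := exists_half_le_norm_of_ofReal_le_eLpNorm_top ha h
    refine ⟨x, ?_⟩
    have heq : cL / 2 * Real.sqrt ν / Real.sqrt (T - t) = cL * Real.sqrt ν / Real.sqrt (T - t) / 2 := by ring
    rw [heq]
    exact hx
  -- the universal velocity bound of `stub_zoomBound` (its constant feeds the `C^{1,κ}` constants)
  obtain ⟨C, hC⟩ := stub_zoomBound
  -- (2) concentrated enstrophy-normalised zooms, by the case splits (Type-I enstrophy / fast doubling /
  -- enstrophy concentration / frequent critical velocity / the kernel)
  obtain ⟨tc, xc, L, s₀, θ, hs₀, hθ, htc, hL, hdom, hpast, hconc⟩ :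
      ∃ (tc : ℕ → ℝ) (xc : ℕ → EuclideanSpace ℝ (Fin 3)) (L : ℕ → ℝ) (s₀ θ : ℝ),
        s₀ < 0 ∧ 0 < θ ∧ (∀ n, 0 < tc n ∧ tc n < T) ∧ (∀ n, 0 < L n) ∧
        (∀ n, ∀ t ∈ Set.Icc 0 (tc n),
          ∫⁻ x, ENNReal.ofReal (frobeniusNormSq (fderiv ℝ (u t) x)) ≤ ENNReal.ofReal (L n)) ∧
        Tendsto (fun n => tc n * L n ^ 2) atTop atTop ∧
        (∀ n, θ ≤ ‖(ν / L n) • u (tc n + ν ^ 3 / L n ^ 2 * s₀) (xc n)‖) := by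
    by_cases hI : ∃ C : ℝ, 0 < C ∧ ∀ t' ∈ Set.Ico 0 T, ∃ t ∈ Set.Ico t' T, ∀ s ∈ Set.Icc 0 t,
        (∫⁻ x, ENNReal.ofReal (frobeniusNormSq (fderiv ℝ (u s) x))) ≤
          ENNReal.ofReal (C * (ν * Real.sqrt ν) / Real.sqrt (T - t))
    · obtain ⟨C, hC, hI⟩ := hI
      exact stub_typeIBranch ν T hν hT u p hcl (cL / 2) (by positivity) hrate cP K hcP hK hpers' C hC hI
    · push Not at hI
      by_cases hFD : ∃ K : ℝ, 0 < K ∧ ∀ t' ∈ Set.Ico 0 T, ∃ t₁ ∈ Set.Ico t' T, ∃ t₂ ∈ Set.Ioo t₁ T,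
          ∃ L : ℝ, 0 < L ∧
            (∀ s ∈ Set.Icc 0 t₂,
              (∫⁻ x, ENNReal.ofReal (frobeniusNormSq (fderiv ℝ (u s) x))) ≤ ENNReal.ofReal (2 * L)) ∧
            (∫⁻ x, ENNReal.ofReal (frobeniusNormSq (fderiv ℝ (u t₁) x))) ≤ ENNReal.ofReal L ∧
            ENNReal.ofReal (2 * L) ≤ (∫⁻ x, ENNReal.ofReal (frobeniusNormSq (fderiv ℝ (u t₂) x))) ∧
            t₂ - t₁ < K * ν ^ 3 / L ^ 2
      · obtain ⟨K₀, hK₀, hFD⟩ := hFD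
        exact stub_fastBranch ν T hν hT u p hcl hLH hrep hnext cP K hcP hK hpers' K₀ hK₀ hFD
      · push Not at hFD
        obtain ⟨C₁, H, κ, hκ, hC1k⟩ := stub_zoomC1kappa stub_oseenC1kappa C hC
        have hC1k' := hC1k ν T hν hT u p hcl hLH hdec hrep
        by_cases hEC : ∃ R ε : ℝ, 0 < R ∧ 0 < ε ∧ ∀ t' ∈ Set.Ico 0 T, ∃ t ∈ Set.Ico t' T,
            ∃ x : EuclideanSpace ℝ (Fin 3), ∃ L : ℝ, 0 < L ∧
              (∀ s ∈ Set.Icc 0 t,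
                (∫⁻ x, ENNReal.ofReal (frobeniusNormSq (fderiv ℝ (u s) x))) ≤ ENNReal.ofReal L) ∧
              3 * ν ^ 3 / L ^ 2 ≤ t ∧
              ENNReal.ofReal (ε * L) ≤
                ∫⁻ y in Metric.ball x (R * ν ^ 2 / L), ENNReal.ofReal (frobeniusNormSq (fderiv ℝ (u t) y))
        · obtain ⟨R, ε, hR, hε, hEC⟩ := hEC
          exact stub_enstrophyConcentrationBranch ν T hν hT u p hcl hLH hrep hnext cP K hcP hK hpers'
            C₁ H κ hκ hC1k' R ε hR hε hEC
        · push Not at hEC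
          by_cases hV : ∃ θ : ℝ, 0 < θ ∧ ∀ t' ∈ Set.Ico 0 T, ∃ t ∈ Set.Ico t' T,
              ∃ x : EuclideanSpace ℝ (Fin 3), ∃ L : ℝ, 0 < L ∧
                (∀ s ∈ Set.Icc 0 t,
                  (∫⁻ x, ENNReal.ofReal (frobeniusNormSq (fderiv ℝ (u s) x))) ≤ ENNReal.ofReal L) ∧
                θ * L / ν ≤ ‖u t x‖
          · obtain ⟨θ, hθ, hV⟩ := hV
            exact stub_velocityBranch ν T hν hT u p hcl hLH hrep hnext cP K hcP hK hpers' θ hθ hV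
          · push Not at hV
            exact (hKernel ν T hν hT u p hcl hLH hdec hnext hI hFD hEC hV).elim
  -- (3) the common tail
  exact recordZoomAncient_of_concentratedZooms ν T hν hT u p hcl hLH hdec tc xc L s₀ θ hs₀ hθ htc hL
    hdom hpast hconc

end Summit.NavierStokesRegularity.NavierStokesRegularity.Theorems.RecordZoomAncient.Birth

end
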